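import Summits.Ventures.YMGap.Census.Decimation
import Summits.Ventures.YMGap.Census.CoeffMonotone
import HarnessLib

/-!
# Venture YMGap, track (b) — Tomboulis's Prop. III.1 for every exponent parameter `0 < r ≤ 1` (even coarse torus)

HONEST FRAMING: venture file of the cell `pub-ymgap` (QuantumFields programme), track (b); finite tori, positivity domain
`f_c ≥ 0`, EVEN coarse side `L`.  Nothing here concerns (5.15), limits, confinement or a mass gap.

Tomboulis, arXiv:0707.2179, end of App. A §4: "it follows from II.1(i), (3.3) and the fact that `0 ≤ c^U_j(m+1,1) ≤ 1` that
replacing `c^U_j(m+1,1)` by `c^U_j(m+1,r)` in the r.h.s. of (A.19) gives a decreasing function in `r` on `0 < r ≤ 1`.  This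
completes the proof of III.1."  Here: `c^U_j(1,r) = ĉ_j^{b²r} ≥ ĉ_j^{b²} = c^U_j(1,1)` for `ĉ_j ∈ [0,1]`
(`CharacterPowerExpansion.hatCoeff_le_one`), both admissible, and II.1 (i) on the coarse torus is the tree theorem
`CoeffMonotone.coeffMonotone` (even `L`, every `J`); with `Decimation.decimationUpperBound_of_nonneg` this is Prop. III.1
(3.4) for every `0 < r ≤ 1` — `decimationUpperBound_of_nonneg_of_le_one`.

References: E. T. Tomboulis, arXiv:0707.2179, Prop. III.1 (3.2)–(3.4), App. A §4 [cite: Tomboulis2007Confinement, Prop. III.1].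
-/

noncomputable section

open MeasureTheory Finset Real
open Literature.MathematicalPhysics.QuantumLattice
open Literature.MathematicalPhysics.QuantumFieldTheory
open Literature.MathematicalPhysics.QuantumFieldTheory.Tomboulis2007

namespace Summit.Ventures.YMGap.Census

variable {d L b : ℕ} [NeZero b] [NeZero L]

omit [NeZero b] [NeZero L] in
/-- The decimated coefficients as real powers of `ĉ_j`: `c^U_j(1,r) = ĉ_j^{b²r}` (definitional). -/
theorem mkCoeff_eq_rpow (J : ℕ) (c : ℕ → ℝ) (ζ : ℕ) (r : ℝ) (n : ℕ) :
    mkCoeff J c ζ b r n = hatCoeff J c ζ n ^ (((b : ℝ) ^ 2) * r) := rfl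

omit [NeZero b] [NeZero L] in
/-- **`0 ≤ c^U_j(1,r) ≤ 1`** on the positivity domain, for `0 ≤ r`. -/
theorem coeffAdmissible_mkCoeff_of_nonneg (J : ℕ) {c : ℕ → ℝ} (hc : ∀ n, 1 ≤ n → 0 ≤ c n)
    (hf : ∀ g : SU2, 0 ≤ plaqFn J c g) (ζ : ℕ) {r : ℝ} (hr : 0 ≤ r) : CoeffAdmissible (mkCoeff J c ζ b r) := by
  intro n _
  rw [mkCoeff_eq_rpow]
  exact ⟨Real.rpow_nonneg (hatCoeff_nonneg hc ζ n) _,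
    Real.rpow_le_one (hatCoeff_nonneg hc ζ n) (hatCoeff_le_one hc hf ζ n) (by positivity)⟩

omit [NeZero b] [NeZero L] in
/-- **`c^U_j(1,1) ≤ c^U_j(1,r)`** for `0 < r ≤ 1` (`ĉ_j ∈ [0,1]`, exponent `b²r ≤ b²`). -/
theorem mkCoeff_one_le_mkCoeff (J : ℕ) {c : ℕ → ℝ} (hc : ∀ n, 1 ≤ n → 0 ≤ c n) (hf : ∀ g : SU2, 0 ≤ plaqFn J c g)
    (ζ : ℕ) {r : ℝ} (hr0 : 0 ≤ r) (hr1 : r ≤ 1) (n : ℕ) : mkCoeff J c ζ b 1 n ≤ mkCoeff J c ζ b r n := by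
  rw [mkCoeff_eq_rpow, mkCoeff_eq_rpow]
  exact Real.rpow_le_rpow_of_exponent_ge' (hatCoeff_nonneg hc ζ n) (hatCoeff_le_one hc hf ζ n) (by positivity)
    (mul_le_mul_of_nonneg_left hr1 (by positivity))

/-- **Tomboulis's Prop. III.1 (arXiv:0707.2179 (3.4)) for every `0 < r ≤ 1` on the positivity domain, even coarse torus**:
`Z_{(ℤ/bL)^d}({c_j}) ≤ F₀^U(1)^{|Λ^{(1)}|} · Z_{(ℤ/L)^d}({c^U_j(1,r)})` (`ζ = b^{d-2}`, `L` even, any `d ≥ 1`, `b ≥ 1`, `J`). -/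
theorem decimationUpperBound_of_nonneg_of_le_one [NeZero d] (hL : Even L) (J : ℕ) {c : ℕ → ℝ} (hc : CoeffAdmissible c)
    (hf : ∀ g : SU2, 0 ≤ plaqFn J c g) {r : ℝ} (hr0 : 0 ≤ r) (hr1 : r ≤ 1) :
    torusZ d (b * L) J c ≤
      mkF0 J c (b ^ (d - 2)) b ^ Fintype.card (Plaquette d L) *
        torusZ d L (b ^ (d - 2) * J) (mkCoeff J c (b ^ (d - 2)) b r) := by
  have hc' : ∀ n, 1 ≤ n → 0 ≤ c n := fun n hn => (hc n hn).1
  haveI : Fact (1 < L) := ⟨by obtain ⟨k, hk⟩ := hL; have := NeZero.ne L; omega⟩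
  refine (decimationUpperBound_of_nonneg J hc hf).trans (mul_le_mul_of_nonneg_left ?_ ?_)
  · exact coeffMonotone hL _ _ _ (coeffAdmissible_mkCoeff_one_of_nonneg hc' hf _ b)
      (coeffAdmissible_mkCoeff_of_nonneg J hc' hf _ hr0) (mkCoeff_one_le_mkCoeff J hc' hf _ hr0 hr1)
  · exact pow_nonneg (zero_le_one.trans (one_le_mkF0 hc' _ b)) _

end Summit.Ventures.YMGap.Census

end
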